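import Literature.Topology.FourManifolds.Isotopy
import HarnessLib

/-!
# Diffeotopies: smooth paths in the diffeomorphism group

Companion to `Isotopy.lean` (smooth isotopies of maps `Literature.Topology.FourManifolds.SmoothIsotopy`, ambient isotopies
`Literature.Topology.FourManifolds.AmbientIsotopy`). A **diffeotopy** of a `C^∞` manifold `N` (Hirsch, *Differential Topology*
(1976), Ch. 8 §1, p. 178: "an isotopy `F : M × I → M` such that each `F_t` is a diffeomorphism";
Cerf (1968), Ch. I §1: a path in the group `Diff`) is recorded here through its **track**
(Hirsch, loc. cit., p. 178): the level-preserving map `(t, x) ↦ (t, F_t x)` of `ℝ × N`, which we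
require to be a *diffeomorphism* of the product manifold `ℝ × N` (model `𝓘(ℝ, ℝ).prod J`),
level-preserving, and equal to the identity at level `0`.

* `Literature.Diffeotopy J N`: the structure (fields `track`, `track_fst`, `track_zero`);
* `Literature.Diffeotopy.toFun D t`, `Literature.Diffeotopy.invFun D t`: the stage `F_t` and its inverse, both
  **jointly** `C^∞` in `(t, x)` (`contMDiff_uncurry_toFun`, `contMDiff_uncurry_invFun`) — this is
  the point of the definition: joint smoothness of the inverse family `(t, y) ↦ F_t⁻¹ y` comes for
  free from `track.symm`, whereas deducing it from joint smoothness of `F` alone is the parametric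
  inverse function theorem, which Mathlib does not have on manifolds (see the TODO in
  `Mathlib.Geometry.Manifold.LocalDiffeomorph`); classically the two notions agree, and we record
  the comparison with `Isotopy.lean` as the real map `Literature.Topology.FourManifolds.Diffeotopy.toAmbientIsotopy` and the
  named fact `Literature.Topology.FourManifolds.AmbientIsotopy.exists_diffeotopy` ("the track of an ambient isotopy is a
  diffeomorphism": every ambient isotopy is the stage family of a diffeotopy; Hirsch (1976),
  Ch. 8 §1), with its corollaries `AmbientIsotopy.isDiffeotopicToId_of_exists_diffeotopy` and
  `Diffeomorph.isDiffeotopicToId_iff_isAmbientIsotopic_of_exists_diffeotopy`; the boundaryless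
  case of the fact is *proved* in the forthcoming `InverseFunctionTheorem.lean`
  (`AmbientIsotopy.exists_diffeotopy_of_boundaryless`,
  `Diffeomorph.isDiffeotopicToId_iff_isAmbientIsotopic`);
* `Literature.Diffeotopy.stage D t : N ≃ₘ⟮J, J⟯ N`: the stage as a bundled diffeomorphism;
* `Literature.Topology.FourManifolds.Diffeotopy.mk'`: constructor from a jointly smooth family with a jointly smooth inverse
  family;
* the group-like operations `Diffeotopy.refl`, `Diffeotopy.trans` (stagewise composition),
  `Diffeotopy.inv` (stagewise inverse), `Diffeotopy.reparam` (time reparametrisation `t ↦ F_{λ t}`,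
  e.g. to make a diffeotopy stationary near `t = 0`);
* `Literature.Diffeomorph.IsDiffeotopicToId φ`: `φ` is the time-`1` stage of a diffeotopy, i.e. lies in
  the identity path-component of `Diff N` (smooth paths); closed under composition and inverse
  (`IsDiffeotopicToId.trans`, `.symm`), and `Literature.Diffeomorph.IsDiffeotopic φ ψ` the induced
  relation `IsDiffeotopicToId (φ.symm.trans ψ)`, an equivalence relation
  (`Literature.Topology.FourManifolds.Diffeomorph.IsDiffeotopic.equivalence`) — all proved, no facts.

Consumers: Cerf's Lemma 2 (`RadialExtension.lean`: a diffeomorphism of `𝕊ⁿ` diffeotopic to the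
identity extends to a diffeomorphism of `𝔻ⁿ⁺¹`), and the statement of Cerf's theorem
`π₀ Diff(S³) = 0`.

## References

* M. W. Hirsch, *Differential Topology*, GTM 33, Springer (1976), Ch. 8 §1 (isotopy, diffeotopy,
  track of an isotopy), pp. 177–178.
* J. Cerf, *Sur les difféomorphismes de la sphère de dimension trois (Γ₄ = 0)*, LNM 53 (1968),
  Ch. I §1.

## Design notes

* Time runs over `ℝ` (as in `Isotopy.lean`), so the product `ℝ × N` is a manifold without new
  boundary; only the stages `t ∈ [0, 1]` matter for `IsDiffeotopicToId`.
* All declarations are in namespace `Literature`; `Literature.Topology.FourManifolds.Diffeomorph.IsDiffeotopicToId` sits next to the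
  tree's `Literature.Topology.FourManifolds.Diffeomorph.IsIsotopic` (not in Mathlib's `Diffeomorph` namespace).
-/

open scoped Manifold ContDiff Topology
open Function Set

noncomputable section

namespace Literature.Topology.FourManifolds

variable {EN HN : Type*} [NormedAddCommGroup EN] [NormedSpace ℝ EN] [TopologicalSpace HN]
  (J : ModelWithCorners ℝ EN HN) (N : Type*) [TopologicalSpace N] [ChartedSpace HN N]

/-- A **diffeotopy** of `N` (a smooth path `t ↦ F_t` in the diffeomorphism group of `N` starting
at the identity), recorded by its **track**: a level-preserving diffeomorphism
`(t, x) ↦ (t, F_t x)` of `ℝ × N` which is the identity at level `t = 0`.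
Hirsch, *Differential Topology* (1976), Ch. 8 §1, p. 178 (diffeotopy; track of an isotopy).
[cite: HirschDT1976, Ch. 8 §1, p. 178] -/
structure Diffeotopy where
  /-- The track `(t, x) ↦ (t, F_t x)`, a diffeomorphism of `ℝ × N`. -/
  track : (ℝ × N) ≃ₘ⟮𝓘(ℝ, ℝ).prod J, 𝓘(ℝ, ℝ).prod J⟯ (ℝ × N)
  /-- The track is level-preserving. -/
  track_fst : ∀ p : ℝ × N, (track p).1 = p.1
  /-- The stage at time `0` is the identity. -/
  track_zero : ∀ x : N, (track (0, x)).2 = x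

namespace Diffeotopy

variable {J N}

/-- The stage `F_t : N → N` of a diffeotopy, as a function. [folklore] -/
def toFun (D : Diffeotopy J N) (t : ℝ) (x : N) : N :=
  (D.track (t, x)).2

/-- The inverse `F_t⁻¹ : N → N` of the stage of a diffeotopy, as a function (read off from the
inverse of the track). [folklore] -/
def invFun (D : Diffeotopy J N) (t : ℝ) (y : N) : N :=
  (D.track.symm (t, y)).2

/-- The inverse of the track is level-preserving as well. [folklore] -/
theorem track_symm_fst (D : Diffeotopy J N) (p : ℝ × N) : (D.track.symm p).1 = p.1 := by
  conv_rhs => rw [← D.track.apply_symm_apply p]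
  exact (D.track_fst _).symm

/-- The track in terms of the stages: `track (t, x) = (t, F_t x)`. [folklore] -/
@[simp]
theorem track_apply (D : Diffeotopy J N) (t : ℝ) (x : N) : D.track (t, x) = (t, D.toFun t x) :=
  Prod.ext (D.track_fst (t, x)) rfl

/-- The inverse track in terms of the inverse stages: `track⁻¹ (t, y) = (t, F_t⁻¹ y)`.
[folklore] -/
@[simp]
theorem track_symm_apply (D : Diffeotopy J N) (t : ℝ) (y : N) :
    D.track.symm (t, y) = (t, D.invFun t y) :=
  Prod.ext (D.track_symm_fst (t, y)) rfl

/-- `F_t (F_t⁻¹ y) = y`. [folklore] -/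
@[simp]
theorem toFun_invFun (D : Diffeotopy J N) (t : ℝ) (y : N) : D.toFun t (D.invFun t y) = y := by
  have h := D.track.apply_symm_apply (t, y)
  rw [track_symm_apply, track_apply] at h
  exact congrArg Prod.snd h

/-- `F_t⁻¹ (F_t x) = x`. [folklore] -/
@[simp]
theorem invFun_toFun (D : Diffeotopy J N) (t : ℝ) (x : N) : D.invFun t (D.toFun t x) = x := by
  have h := D.track.symm_apply_apply (t, x)
  rw [track_apply, track_symm_apply] at h
  exact congrArg Prod.snd h

/-- The stage at time `0` is the identity. [folklore] -/
@[simp]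
theorem toFun_zero (D : Diffeotopy J N) : D.toFun 0 = id :=
  funext D.track_zero

/-- The inverse stage at time `0` is the identity. [folklore] -/
@[simp]
theorem invFun_zero (D : Diffeotopy J N) : D.invFun 0 = id := by
  funext y
  simpa using D.invFun_toFun 0 y

/-- **Joint smoothness of the stages** `(t, x) ↦ F_t x`. [folklore] -/
theorem contMDiff_uncurry_toFun (D : Diffeotopy J N) :
    ContMDiff (𝓘(ℝ, ℝ).prod J) J ∞ (uncurry D.toFun) :=
  contMDiff_snd.comp D.track.contMDiff

/-- **Joint smoothness of the inverse stages** `(t, y) ↦ F_t⁻¹ y` (from the inverse of the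
track; classically this is the parametric inverse function theorem). [folklore] -/
theorem contMDiff_uncurry_invFun (D : Diffeotopy J N) :
    ContMDiff (𝓘(ℝ, ℝ).prod J) J ∞ (uncurry D.invFun) :=
  contMDiff_snd.comp D.track.symm.contMDiff

/-- The slice inclusion `x ↦ (t, x)` of `N` into `ℝ × N` is smooth. [folklore] -/
theorem contMDiff_slice (t : ℝ) : ContMDiff J (𝓘(ℝ, ℝ).prod J) ∞ fun x : N => (t, x) :=
  contMDiff_const.prodMk contMDiff_id

/-- Each stage `F_t` is smooth. [folklore] -/
theorem contMDiff_toFun (D : Diffeotopy J N) (t : ℝ) : ContMDiff J J ∞ (D.toFun t) :=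
  D.contMDiff_uncurry_toFun.comp (contMDiff_slice t)

/-- Each inverse stage `F_t⁻¹` is smooth. [folklore] -/
theorem contMDiff_invFun (D : Diffeotopy J N) (t : ℝ) : ContMDiff J J ∞ (D.invFun t) :=
  D.contMDiff_uncurry_invFun.comp (contMDiff_slice t)

/-- **The stage `F_t` of a diffeotopy as a diffeomorphism of `N`.** Hirsch (1976), Ch. 8 §1.
[folklore] -/
def stage (D : Diffeotopy J N) (t : ℝ) : N ≃ₘ⟮J, J⟯ N where
  toFun := D.toFun t
  invFun := D.invFun t
  left_inv := D.invFun_toFun t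
  right_inv := D.toFun_invFun t
  contMDiff_toFun := D.contMDiff_toFun t
  contMDiff_invFun := D.contMDiff_invFun t

/-- The stage diffeomorphism is, as a function, `F_t` (definitional). [folklore] -/
@[simp]
theorem coe_stage (D : Diffeotopy J N) (t : ℝ) : ⇑(D.stage t) = D.toFun t := rfl

/-- The inverse of the stage diffeomorphism is, as a function, `F_t⁻¹` (definitional).
[folklore] -/
@[simp]
theorem coe_stage_symm (D : Diffeotopy J N) (t : ℝ) : ⇑(D.stage t).symm = D.invFun t := rfl

/-- The stage at time `0` is the identity diffeomorphism. [folklore] -/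
theorem stage_zero (D : Diffeotopy J N) : D.stage 0 = Diffeomorph.refl J N ∞ :=
  Diffeomorph.ext fun x => by simp

/-- **A diffeotopy is an ambient isotopy** in the sense of `Isotopy.lean` (forget that the inverse
family is jointly smooth): each stage is a bijective local diffeomorphism.
Hirsch (1976), Ch. 8 §1, p. 178. [folklore] -/
def toAmbientIsotopy (D : Diffeotopy J N) : AmbientIsotopy J N where
  toFun := D.toFun
  contMDiff := D.contMDiff_uncurry_toFun
  bijective t := (D.stage t).bijective
  isLocalDiffeomorph t := (D.stage t).isLocalDiffeomorph
  map_zero := D.toFun_zero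

/-- Stages of the underlying ambient isotopy (definitional). [folklore] -/
@[simp]
theorem toAmbientIsotopy_toFun (D : Diffeotopy J N) : D.toAmbientIsotopy.toFun = D.toFun := rfl

/-! ### Constructor from a family and its inverse family -/

variable (J) in
/-- **A diffeotopy from a jointly smooth family of maps together with a jointly smooth inverse
family** (`G_t ∘ F_t = id = F_t ∘ G_t`, `F_0 = id`): the track `(t, x) ↦ (t, F_t x)` has the
smooth inverse `(t, y) ↦ (t, G_t y)`. [folklore] -/
def mk' (F G : ℝ → N → N) (hF : ContMDiff (𝓘(ℝ, ℝ).prod J) J ∞ (uncurry F))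
    (hG : ContMDiff (𝓘(ℝ, ℝ).prod J) J ∞ (uncurry G)) (hGF : ∀ t x, G t (F t x) = x)
    (hFG : ∀ t y, F t (G t y) = y) (h0 : F 0 = id) : Diffeotopy J N where
  track :=
    { toFun := fun p => (p.1, F p.1 p.2)
      invFun := fun p => (p.1, G p.1 p.2)
      left_inv := fun p => by simp [hGF]
      right_inv := fun p => by simp [hFG]
      contMDiff_toFun := contMDiff_fst.prodMk hF
      contMDiff_invFun := contMDiff_fst.prodMk hG }
  track_fst _ := rfl
  track_zero x := by
    change F 0 x = x
    rw [h0, id]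

/-- Stages of `Diffeotopy.mk'` (definitional). [folklore] -/
@[simp]
theorem mk'_toFun (F G : ℝ → N → N) (hF : ContMDiff (𝓘(ℝ, ℝ).prod J) J ∞ (uncurry F))
    (hG : ContMDiff (𝓘(ℝ, ℝ).prod J) J ∞ (uncurry G)) (hGF : ∀ t x, G t (F t x) = x)
    (hFG : ∀ t y, F t (G t y) = y) (h0 : F 0 = id) :
    (mk' J F G hF hG hGF hFG h0).toFun = F := rfl

/-- Inverse stages of `Diffeotopy.mk'` (definitional). [folklore] -/
@[simp]
theorem mk'_invFun (F G : ℝ → N → N) (hF : ContMDiff (𝓘(ℝ, ℝ).prod J) J ∞ (uncurry F))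
    (hG : ContMDiff (𝓘(ℝ, ℝ).prod J) J ∞ (uncurry G)) (hGF : ∀ t x, G t (F t x) = x)
    (hFG : ∀ t y, F t (G t y) = y) (h0 : F 0 = id) :
    (mk' J F G hF hG hGF hFG h0).invFun = G := rfl

/-! ### Operations: constant path, stagewise composition and inverse, reparametrisation -/

variable (J N) in
/-- The constant diffeotopy at the identity. [folklore] -/
protected def refl : Diffeotopy J N where
  track := Diffeomorph.refl _ _ _
  track_fst _ := rfl
  track_zero _ := rfl

/-- Stages of the constant diffeotopy. [folklore] -/
@[simp]
theorem refl_toFun (t : ℝ) : (Diffeotopy.refl J N).toFun t = id := rfl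

/-- **Stagewise composition** of diffeotopies, in Mathlib's `trans` order:
`(D.trans D') _t = D'_t ∘ D_t` (compose the tracks, `D.track.trans D'.track`).
Hirsch (1976), Ch. 8 §1. [folklore] -/
def trans (D D' : Diffeotopy J N) : Diffeotopy J N where
  track := D.track.trans D'.track
  track_fst p := by
    rw [Diffeomorph.coe_trans, comp_apply, D'.track_fst, D.track_fst]
  track_zero x := by
    rw [Diffeomorph.coe_trans, comp_apply, D.track_apply 0 x, D.toFun_zero, id, D'.track_apply 0 x,
      D'.toFun_zero, id]

/-- Stages of the stagewise composition. [folklore] -/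
@[simp]
theorem trans_toFun (D D' : Diffeotopy J N) (t : ℝ) :
    (D.trans D').toFun t = D'.toFun t ∘ D.toFun t := by
  funext x
  change (D'.track (D.track (t, x))).2 = _
  rw [D.track_apply t x]
  rfl

/-- **Stagewise inverse** of a diffeotopy: `(D.inv) _t = (D_t)⁻¹` (invert the track).
[folklore] -/
def inv (D : Diffeotopy J N) : Diffeotopy J N where
  track := D.track.symm
  track_fst := D.track_symm_fst
  track_zero x := by
    rw [track_symm_apply, D.invFun_zero, id]

/-- Stages of the stagewise inverse. [folklore] -/
@[simp]
theorem inv_toFun (D : Diffeotopy J N) (t : ℝ) : D.inv.toFun t = D.invFun t :=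
  rfl

/-- **Time reparametrisation** of a diffeotopy along a smooth `l : ℝ → ℝ` with `l 0 = 0`:
stages `t ↦ F_{l t}`. With `l` a smooth step function this makes a diffeotopy stationary near
`t = 0` (and near `t = 1`), as in Cerf (1968), Ch. I §1, proof of Lemme 2. [folklore] -/
def reparam (D : Diffeotopy J N) (l : ℝ → ℝ) (hl : ContDiff ℝ ∞ l) (hl0 : l 0 = 0) :
    Diffeotopy J N where
  track :=
    { toFun := fun p => (p.1, D.toFun (l p.1) p.2)
      invFun := fun p => (p.1, D.invFun (l p.1) p.2)
      left_inv := fun p => by simp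
      right_inv := fun p => by simp
      contMDiff_toFun := by
        refine contMDiff_fst.prodMk (D.contMDiff_uncurry_toFun.comp (f := fun p : ℝ × N =>
          (l p.1, p.2)) ?_)
        exact (hl.contMDiff.comp contMDiff_fst).prodMk contMDiff_snd
      contMDiff_invFun := by
        refine contMDiff_fst.prodMk (D.contMDiff_uncurry_invFun.comp (f := fun p : ℝ × N =>
          (l p.1, p.2)) ?_)
        exact (hl.contMDiff.comp contMDiff_fst).prodMk contMDiff_snd }
  track_fst _ := rfl
  track_zero x := by
    change D.toFun (l 0) x = x
    rw [hl0, D.toFun_zero, id]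

/-- Stages of the reparametrised diffeotopy. [folklore] -/
@[simp]
theorem reparam_toFun (D : Diffeotopy J N) (l : ℝ → ℝ) (hl : ContDiff ℝ ∞ l) (hl0 : l 0 = 0)
    (t : ℝ) : (D.reparam l hl hl0).toFun t = D.toFun (l t) := rfl

/-- Inverse stages of the reparametrised diffeotopy. [folklore] -/
@[simp]
theorem reparam_invFun (D : Diffeotopy J N) (l : ℝ → ℝ) (hl : ContDiff ℝ ∞ l) (hl0 : l 0 = 0)
    (t : ℝ) : (D.reparam l hl hl0).invFun t = D.invFun (l t) := rfl

end Diffeotopy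

/-! ### The identity component of the diffeomorphism group -/

namespace Diffeomorph

variable {J N}

/-- A self-diffeomorphism `φ` of `N` is **diffeotopic to the identity** if it is the time-`1`
stage of a diffeotopy of `N`, i.e. `φ` lies in the identity path-component of `Diff N` for
smooth paths (Cerf (1968), Ch. I §1: "la composante connexe de l'élément neutre de `Diff`";
Hirsch (1976), Ch. 8 §1, diffeotopy). This is `Literature.Topology.FourManifolds.Diffeomorph.IsDiffeotopicToId`.
[cite: HirschDT1976, Ch. 8 §1, p. 178] -/
def IsDiffeotopicToId (φ : N ≃ₘ⟮J, J⟯ N) : Prop :=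
  ∃ D : Diffeotopy J N, D.stage 1 = φ

/-- The identity is diffeotopic to the identity (constant path). [folklore] -/
theorem isDiffeotopicToId_refl : IsDiffeotopicToId (Diffeomorph.refl J N ∞) :=
  ⟨Diffeotopy.refl J N, Diffeomorph.ext fun _ => rfl⟩

/-- Diffeomorphisms diffeotopic to the identity are closed under composition (compose the
paths stagewise): the identity path-component of `Diff N` is a subgroup. [folklore] -/
theorem IsDiffeotopicToId.trans {φ ψ : N ≃ₘ⟮J, J⟯ N} (hφ : IsDiffeotopicToId φ)
    (hψ : IsDiffeotopicToId ψ) : IsDiffeotopicToId (φ.trans ψ) := by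
  obtain ⟨D, rfl⟩ := hφ
  obtain ⟨D', rfl⟩ := hψ
  exact ⟨D.trans D', Diffeomorph.ext fun x => by simp⟩

/-- Diffeomorphisms diffeotopic to the identity are closed under inversion (invert the path
stagewise). [folklore] -/
theorem IsDiffeotopicToId.symm {φ : N ≃ₘ⟮J, J⟯ N} (hφ : IsDiffeotopicToId φ) :
    IsDiffeotopicToId φ.symm := by
  obtain ⟨D, rfl⟩ := hφ
  exact ⟨D.inv, Diffeomorph.ext fun x => by simp⟩

/-- A diffeomorphism diffeotopic to the identity is ambient isotopic to the identity in the
sense of `Isotopy.lean`. [folklore] -/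
theorem IsDiffeotopicToId.isAmbientIsotopic {φ : N ≃ₘ⟮J, J⟯ N} (hφ : IsDiffeotopicToId φ) :
    IsAmbientIsotopic J J (id : N → N) ⇑φ := by
  obtain ⟨D, rfl⟩ := hφ
  exact ⟨D.toAmbientIsotopy, rfl⟩

/-- Two self-diffeomorphisms are **diffeotopic** if `ψ ∘ φ⁻¹` is diffeotopic to the identity,
i.e. `ψ = F_1 ∘ φ` for a diffeotopy `F` (a smooth path from `φ` to `ψ` in `Diff N`).
Hirsch (1976), Ch. 8 §1. This is `Literature.Topology.FourManifolds.Diffeomorph.IsDiffeotopic`. [folklore] -/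
def IsDiffeotopic (φ ψ : N ≃ₘ⟮J, J⟯ N) : Prop :=
  IsDiffeotopicToId (φ.symm.trans ψ)

/-- Unfolding lemma for `IsDiffeotopic`. [folklore] -/
theorem isDiffeotopic_iff (φ ψ : N ≃ₘ⟮J, J⟯ N) :
    IsDiffeotopic φ ψ ↔ IsDiffeotopicToId (φ.symm.trans ψ) :=
  Iff.rfl

/-- `φ` is diffeotopic to the identity iff it is diffeotopic to `id` in the two-variable sense.
[folklore] -/
theorem isDiffeotopic_refl_iff (φ : N ≃ₘ⟮J, J⟯ N) :
    IsDiffeotopic (Diffeomorph.refl J N ∞) φ ↔ IsDiffeotopicToId φ := by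
  rw [isDiffeotopic_iff]
  congr! 1

/-- Diffeotopy is reflexive. [folklore] -/
theorem IsDiffeotopic.refl (φ : N ≃ₘ⟮J, J⟯ N) : IsDiffeotopic φ φ := by
  rw [isDiffeotopic_iff, Diffeomorph.symm_trans_self]
  exact isDiffeotopicToId_refl

/-- Diffeotopy is symmetric. [folklore] -/
theorem IsDiffeotopic.symm {φ ψ : N ≃ₘ⟮J, J⟯ N} (h : IsDiffeotopic φ ψ) : IsDiffeotopic ψ φ := by
  rw [isDiffeotopic_iff] at h ⊢
  convert h.symm using 1
  exact Diffeomorph.ext fun x => rfl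

/-- Diffeotopy is transitive. [folklore] -/
theorem IsDiffeotopic.trans {φ ψ χ : N ≃ₘ⟮J, J⟯ N} (h₁ : IsDiffeotopic φ ψ)
    (h₂ : IsDiffeotopic ψ χ) : IsDiffeotopic φ χ := by
  rw [isDiffeotopic_iff] at h₁ h₂ ⊢
  convert h₁.trans h₂ using 1
  ext x
  simp

variable (J N) in
/-- **Diffeotopy is an equivalence relation** on the self-diffeomorphisms of `N` (proved; compare
the named facts `Diffeomorph.IsIsotopic.trans`, `equivalence_isAmbientIsotopic` of
`Isotopy.lean` for the isotopy-through-embeddings notions). Hirsch (1976), Ch. 8 §1. [folklore] -/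
theorem IsDiffeotopic.equivalence :
    Equivalence (IsDiffeotopic : (N ≃ₘ⟮J, J⟯ N) → (N ≃ₘ⟮J, J⟯ N) → Prop) :=
  ⟨IsDiffeotopic.refl, IsDiffeotopic.symm, IsDiffeotopic.trans⟩

/-- Diffeotopic diffeomorphisms are ambient isotopic as maps (`Isotopy.lean`). [folklore] -/
theorem IsDiffeotopic.isAmbientIsotopic {φ ψ : N ≃ₘ⟮J, J⟯ N} (h : IsDiffeotopic φ ψ) :
    IsAmbientIsotopic J J ⇑φ ⇑ψ := by
  obtain ⟨D, hD⟩ := h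
  refine ⟨D.toAmbientIsotopy, ?_⟩
  funext x
  have := congrArg (fun χ : N ≃ₘ⟮J, J⟯ N => χ (φ x)) hD
  simpa using this

end Diffeomorph

universe u v w in
/-- NAMED FACT (**the track of an ambient isotopy is a diffeomorphism**; parametric inverse
function theorem). For an ambient isotopy `F` of a finite-dimensional `C^∞` manifold `N`
(finite-dimensional model space, as in Hirsch; possibly with boundary or corners) in the sense of
`Isotopy.lean` (stages bijective local diffeomorphisms, `(t, x) ↦ F_t x` jointly `C^∞`), the
inverse family `(t, y) ↦ F_t⁻¹ y` is jointly `C^∞` as well, i.e. `F` *is* (the family of stages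
of) a diffeotopy in the sense of `Diffeotopy`: `∃ D : Diffeotopy J N, D.toFun = F.toFun`.
Classical (inverse function theorem applied to the track `(t, x) ↦ (t, F_t x)`, whose
differential is block-triangular with invertible diagonal blocks); the boundaryless case (for
any complete model space) is proved in the forthcoming `InverseFunctionTheorem.lean`
(`AmbientIsotopy.exists_diffeotopy_of_boundaryless`), the general case (models with boundary or
corners) is not provable from Mathlib at present (no inverse function theorem on such manifolds,
cf. the TODO in `Mathlib.Geometry.Manifold.LocalDiffeomorph`). Hirsch (1976), Ch. 8 §1, p. 178.
[cite: HirschDT1976, Ch. 8 §1, p. 178] -/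
def AmbientIsotopy.exists_diffeotopy : Prop :=
  ∀ {EN : Type u} {HN : Type v} [NormedAddCommGroup EN] [NormedSpace ℝ EN]
    [FiniteDimensional ℝ EN] [TopologicalSpace HN] {J : ModelWithCorners ℝ EN HN} {N : Type w}
    [TopologicalSpace N] [ChartedSpace HN N] [IsManifold J ∞ N] (F : AmbientIsotopy J N),
    ∃ D : Diffeotopy J N, D.toFun = F.toFun

universe u v w in
/-- Corollary of the named fact `AmbientIsotopy.exists_diffeotopy`: **every stage `F_t` of an
ambient isotopy is diffeotopic to the identity** (reparametrise the diffeotopy with stages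
`F` by `s ↦ t s`). Hirsch (1976), Ch. 8 §1, p. 178. [cite: HirschDT1976, Ch. 8 §1, p. 178] -/
theorem AmbientIsotopy.isDiffeotopicToId_of_exists_diffeotopy
    (h : AmbientIsotopy.exists_diffeotopy.{u, v, w}) {EN : Type u} {HN : Type v}
    [NormedAddCommGroup EN] [NormedSpace ℝ EN] [FiniteDimensional ℝ EN] [TopologicalSpace HN]
    {J : ModelWithCorners ℝ EN HN} {N : Type w} [TopologicalSpace N] [ChartedSpace HN N]
    [IsManifold J ∞ N] (F : AmbientIsotopy J N) (t : ℝ) :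
    Diffeomorph.IsDiffeotopicToId (F.toDiffeomorph t) := by
  obtain ⟨D, hD⟩ := h F
  refine ⟨D.reparam (fun s => t * s) (contDiff_const.mul contDiff_id) (mul_zero t),
    Diffeomorph.ext fun x => ?_⟩
  simp [hD]

universe u v w in
/-- Given the named fact `AmbientIsotopy.exists_diffeotopy`, **diffeotopic to the identity =
ambient isotopic to the identity** (`Diffeotopy.lean` vs `Isotopy.lean`); the unconditional
boundaryless case is `Diffeomorph.isDiffeotopicToId_iff_isAmbientIsotopic` (forthcoming
`InverseFunctionTheorem.lean`). [folklore] -/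
theorem Diffeomorph.isDiffeotopicToId_iff_isAmbientIsotopic_of_exists_diffeotopy
    (h : AmbientIsotopy.exists_diffeotopy.{u, v, w}) {EN : Type u} {HN : Type v}
    [NormedAddCommGroup EN] [NormedSpace ℝ EN] [FiniteDimensional ℝ EN] [TopologicalSpace HN]
    {J : ModelWithCorners ℝ EN HN} {N : Type w} [TopologicalSpace N] [ChartedSpace HN N]
    [IsManifold J ∞ N] (φ : N ≃ₘ⟮J, J⟯ N) :
    Diffeomorph.IsDiffeotopicToId φ ↔ IsAmbientIsotopic J J (id : N → N) ⇑φ := by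
  refine ⟨Diffeomorph.IsDiffeotopicToId.isAmbientIsotopic, ?_⟩
  rintro ⟨F, hF⟩
  have hφ : F.toDiffeomorph 1 = φ := Diffeomorph.ext fun x => congrFun hF x
  exact hφ ▸ AmbientIsotopy.isDiffeotopicToId_of_exists_diffeotopy h F 1

end Literature.Topology.FourManifolds

end
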